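import Mathlib
import Summits.AtomisticToContinuum.HydrodynamicLimit.Theses.CollisionIsometryCLT
import Literature.Probability.Entropy.EntropyInequality
import Literature.Analysis.FluidPDE.HardSphereDynamicsProofs

/-!
# Crux `MacroClosure` (stmt-AtomisticToContinuum-14670) — ideator 3 sketch: Liouville–Yau transport

Scratch file for the crux idea card `liouville-yau-transport` (planner crux-ideate, round 1).
Nothing here is a route item; the declarations only certify that the card's FIRST LEMMA and its
TRANSFER form C⁺ are typable over existing declarations.

* `EntropyTransportIdentity` — FIRST LEMMA: the exact Liouville transport identity for the
  relative entropy of the evolved law against a MOVING absolutely continuous reference family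
  `ψ_t · dZ`: `H((Φ_t)_* P₀ | ψ_t dZ) = H(P₀ | ψ_0 dZ) + E_{P₀}[log ψ_0 − log ψ_t ∘ Φ_t]`.
  Only `HardSphereFlow.measurePreserving` (Liouville invariance) and bookkeeping are needed; no
  generator, no differentiability of the flow. PROVED below as `entropyTransportIdentity_holds`
  (helpers `llr_withDensity_ofReal_ae`, `toReal_klDiv_withDensity_ofReal`; standard axioms).
* `YauForm` — the conclusion of the transfer C⁺: vanishing specific relative entropy of the time-`t`
  law against a local Gibbs law carrying the Euler parameters at time `t`, together with the static
  exponential concentration of that reference law (shape of the retired route decl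
  `RelEntropyErgodic.RelEntropyVanishing`, re-typed here).
* `RelEntropyClosure` — C⁺ itself: the three hypotheses of `MacroClosure` imply `YauForm`.
* `transfer_shape` — PROVED: `(YauForm → HydrodynamicLimit) → RelEntropyClosure → MacroClosure`.
-/

noncomputable section

open MeasureTheory Filter Set Topology
open scoped ENNReal

namespace Summit.AtomisticToContinuum.HydrodynamicLimit.Cruxes.MacroClosure.LiouvilleYauTransport

open Literature.Analysis.FluidPDE
open Literature.MathematicalPhysics.KineticTheory
open Summit.AtomisticToContinuum.HydrodynamicLimit.Theses.CollisionIsometryCLT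

/-- FIRST LEMMA (Liouville transport identity for the relative entropy against a moving reference).
For `N + 1` hard spheres of diameter `ε` on `𝕋³`, any hard-sphere flow `Φ`, an initial law
`P₀ = W₀ · dZ` (density w.r.t. the Liouville measure) and a time-indexed family of positive
reference densities `ψ t` (each `ψ t · dZ` a probability measure): for every `t`,
`H((Φ_t)_* P₀ ‖ ψ_t dZ) = H(P₀ ‖ ψ_0 dZ) + ∫ (log ψ 0 z − log ψ t (Φ_t z)) dP₀(z)`.
Proof idea: `∫ f_t log f_t dZ = ∫ f_0 log f_0 dZ` because `f_t = f_0 ∘ Φ_{−t}` and `Φ_t`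
preserves `dZ` (`HardSphereFlow.measurePreserving`), while
`∫ f_t log ψ_t dZ = E_{P₀}[log ψ_t ∘ Φ_t]` by change of variables. [cite: Yau1991]
[cite: OllaVaradhanYau1993, §3 Lemma 3.1–3.3] [cite: KipnisLandim1999, Ch. 6 Lemma 1.4] -/
def EntropyTransportIdentity : Prop :=
  ∀ (N : ℕ) (ε : ℝ)
    (Φ : HardSphereFlow (Torus.geometry (Fin 3)) ε (N + 1))
    (W₀ : Config (N + 1) (Fin 3) (UnitAddTorus (Fin 3)) → ℝ)
    (ψ : ℝ → Config (N + 1) (Fin 3) (UnitAddTorus (Fin 3)) → ℝ),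
    Measurable W₀ → (∀ t, Measurable (ψ t)) → (∀ z, 0 ≤ W₀ z) → (∀ t z, 0 < ψ t z) →
    IsProbabilityMeasure (particleLaw Φ W₀) →
    (∀ t, IsProbabilityMeasure
      ((liouville (Torus.geometry (Fin 3)) (N + 1) ε).withDensity fun z => ENNReal.ofReal (ψ t z))) →
    InformationTheory.klDiv (particleLaw Φ W₀)
        ((liouville (Torus.geometry (Fin 3)) (N + 1) ε).withDensity
          fun z => ENNReal.ofReal (ψ 0 z)) ≠ ⊤ →
    (∀ t, Integrable (fun z => Real.log (ψ t (Φ.flow t z))) (particleLaw Φ W₀)) →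
    ∀ t : ℝ,
      (InformationTheory.klDiv (Φ.lawAt (particleLaw Φ W₀) t)
          ((liouville (Torus.geometry (Fin 3)) (N + 1) ε).withDensity
            fun z => ENNReal.ofReal (ψ t z))).toReal =
        (InformationTheory.klDiv (particleLaw Φ W₀)
            ((liouville (Torus.geometry (Fin 3)) (N + 1) ε).withDensity
              fun z => ENNReal.ofReal (ψ 0 z))).toReal +
          ∫ z, (Real.log (ψ 0 z) - Real.log (ψ t (Φ.flow t z))) ∂(particleLaw Φ W₀)

open InformationTheory in
/-- Log-likelihood ratio between two absolutely continuous laws `W·L` and `ψ·L` with `W ≥ 0`,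
`ψ > 0` real densities: `llr = log W − log ψ` almost everywhere under `W·L`. [folklore] -/
theorem llr_withDensity_ofReal_ae {α : Type*} [MeasurableSpace α] (L : Measure α) [SigmaFinite L]
    {W ψ : α → ℝ} (hW : Measurable W) (hψ : Measurable ψ) (hW0 : ∀ x, 0 ≤ W x)
    (hψpos : ∀ x, 0 < ψ x)
    [IsProbabilityMeasure (L.withDensity fun x => ENNReal.ofReal (W x))] :
    llr (L.withDensity fun x => ENNReal.ofReal (W x)) (L.withDensity fun x => ENNReal.ofReal (ψ x))
      =ᵐ[L.withDensity fun x => ENNReal.ofReal (W x)] fun x => Real.log (W x) - Real.log (ψ x) := by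
  have hf : Measurable fun x => ENNReal.ofReal (W x) := ENNReal.measurable_ofReal.comp hW
  have hg : Measurable fun x => ENNReal.ofReal (ψ x) := ENNReal.measurable_ofReal.comp hψ
  have hg0 : ∀ᵐ x ∂L, ENNReal.ofReal (ψ x) ≠ 0 :=
    ae_of_all _ fun x => (ENNReal.ofReal_pos.mpr (hψpos x)).ne'
  have hgtop : ∀ᵐ x ∂L, ENNReal.ofReal (ψ x) ≠ ∞ := ae_of_all _ fun x => ENNReal.ofReal_ne_top
  have hμL : (L.withDensity fun x => ENNReal.ofReal (W x)) ≪ L := withDensity_absolutelyContinuous _ _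
  have h1 : (L.withDensity fun x => ENNReal.ofReal (W x)).rnDeriv
        (L.withDensity fun x => ENNReal.ofReal (ψ x))
      =ᵐ[L] fun x => (ENNReal.ofReal (ψ x))⁻¹ *
        (L.withDensity fun x => ENNReal.ofReal (W x)).rnDeriv L x :=
    Measure.rnDeriv_withDensity_right _ L hg.aemeasurable hg0 hgtop
  have h2 : (L.withDensity fun x => ENNReal.ofReal (W x)).rnDeriv L
      =ᵐ[L] fun x => ENNReal.ofReal (W x) :=
    Measure.rnDeriv_withDensity L hf
  have h3 : ∀ᵐ x ∂(L.withDensity fun x => ENNReal.ofReal (W x)), ENNReal.ofReal (W x) ≠ 0 :=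
    (ae_withDensity_iff hf).mpr (ae_of_all _ fun x hx => hx)
  filter_upwards [hμL.ae_le h1, hμL.ae_le h2, h3] with x hx1 hx2 hx3
  have hWpos : 0 < W x := by
    rcases (hW0 x).lt_or_eq with h | h
    · exact h
    · exact absurd (by rw [← h, ENNReal.ofReal_zero]) hx3
  simp only [MeasureTheory.llr, hx1, hx2]
  rw [ENNReal.toReal_mul, ENNReal.toReal_inv, ENNReal.toReal_ofReal (hψpos x).le,
    ENNReal.toReal_ofReal (hW0 x), Real.log_mul (inv_ne_zero (hψpos x).ne') hWpos.ne',
    Real.log_inv]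
  ring

open InformationTheory in
/-- Relative entropy between two absolutely continuous probability laws `W·L` and `ψ·L` with
`W ≥ 0`, `ψ > 0`: `H(W·L ‖ ψ·L) = ∫ (log W − log ψ) d(W·L)` (junk-consistent: both sides are `0`
if the integrand is not integrable). [folklore] -/
theorem toReal_klDiv_withDensity_ofReal {α : Type*} [MeasurableSpace α] (L : Measure α)
    [SigmaFinite L] {W ψ : α → ℝ} (hW : Measurable W) (hψ : Measurable ψ) (hW0 : ∀ x, 0 ≤ W x)
    (hψpos : ∀ x, 0 < ψ x)
    [IsProbabilityMeasure (L.withDensity fun x => ENNReal.ofReal (W x))]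
    [IsProbabilityMeasure (L.withDensity fun x => ENNReal.ofReal (ψ x))] :
    (klDiv (L.withDensity fun x => ENNReal.ofReal (W x))
        (L.withDensity fun x => ENNReal.ofReal (ψ x))).toReal =
      ∫ x, (Real.log (W x) - Real.log (ψ x)) ∂(L.withDensity fun x => ENNReal.ofReal (W x)) := by
  have hg : Measurable fun x => ENNReal.ofReal (ψ x) := ENNReal.measurable_ofReal.comp hψ
  have hg0 : ∀ᵐ x ∂L, ENNReal.ofReal (ψ x) ≠ 0 :=
    ae_of_all _ fun x => (ENNReal.ofReal_pos.mpr (hψpos x)).ne'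
  have hμL : (L.withDensity fun x => ENNReal.ofReal (W x)) ≪ L := withDensity_absolutelyContinuous _ _
  have hLν : L ≪ (L.withDensity fun x => ENNReal.ofReal (ψ x)) :=
    withDensity_absolutelyContinuous' hg.aemeasurable hg0
  rw [toReal_klDiv_of_measure_eq (hμL.trans hLν) (by rw [measure_univ, measure_univ])]
  exact integral_congr_ae (llr_withDensity_ofReal_ae L hW hψ hW0 hψpos)

open InformationTheory in
/-- **The first lemma holds**: proof of `EntropyTransportIdentity` from Liouville invariance
(`HardSphereFlow.lawAt_withDensity_holds`, `flow_neg_flow`, `ae_mem_good`) and the explicit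
log-likelihood ratio of absolutely continuous laws. [folklore] -/
theorem entropyTransportIdentity_holds : EntropyTransportIdentity := by
  intro N ε Φ W₀ ψ hW hψ hW0 hψpos hP hΨ hkl hint t
  rw [particleLaw_eq] at hP hkl hint ⊢
  -- instance shortcuts (the search for `SigmaFinite` on configuration spaces is deep)
  haveI hXE : SigmaFinite (volume : Measure (UnitAddTorus (Fin 3) × EuclideanSpace ℝ (Fin 3))) :=
    inferInstance
  haveI hCfg : SigmaFinite (volume : Measure (Config (N + 1) (Fin 3) (UnitAddTorus (Fin 3)))) :=
    inferInstance
  haveI hL : SigmaFinite (liouville (Torus.geometry (Fin 3)) (N + 1) ε) := by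
    rw [liouville_eq]; infer_instance
  have hf : Measurable fun z => ENNReal.ofReal (W₀ z) := ENNReal.measurable_ofReal.comp hW
  have hμL : ((liouville (Torus.geometry (Fin 3)) (N + 1) ε).withDensity
      fun z => ENNReal.ofReal (W₀ z)) ≪ liouville (Torus.geometry (Fin 3)) (N + 1) ε :=
    withDensity_absolutelyContinuous _ _
  have hgood : ∀ᵐ z ∂((liouville (Torus.geometry (Fin 3)) (N + 1) ε).withDensity
      fun z => ENNReal.ofReal (W₀ z)), z ∈ Φ.good := hμL.ae_le Φ.ae_mem_good
  -- the law at time `t` has density `W₀ ∘ Φ_{-t}` (mild Liouville equation)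
  have hlaw : Φ.lawAt ((liouville (Torus.geometry (Fin 3)) (N + 1) ε).withDensity
        fun z => ENNReal.ofReal (W₀ z)) t =
      (liouville (Torus.geometry (Fin 3)) (N + 1) ε).withDensity
        fun z => ENNReal.ofReal (W₀ (Φ.flow (-t) z)) :=
    HardSphereFlow.lawAt_withDensity_holds Φ hf t
  have hPt : IsProbabilityMeasure ((liouville (Torus.geometry (Fin 3)) (N + 1) ε).withDensity
      fun z => ENNReal.ofReal (W₀ (Φ.flow (-t) z))) := by
    rw [← hlaw, HardSphereFlow.lawAt_eq]
    exact Measure.isProbabilityMeasure_map (Φ.measurable_flow t).aemeasurable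
  have hΨt := hΨ t
  have hΨ0 := hΨ 0
  rw [hlaw, toReal_klDiv_withDensity_ofReal (W := fun z => W₀ (Φ.flow (-t) z))
      (liouville (Torus.geometry (Fin 3)) (N + 1) ε) (hW.comp (Φ.measurable_flow (-t))) (hψ t)
      (fun z => hW0 _) (hψpos t),
    toReal_klDiv_withDensity_ofReal (liouville (Torus.geometry (Fin 3)) (N + 1) ε) hW (hψ 0) hW0
      (hψpos 0)]
  -- back to the push-forward to integrate along the flow
  have hF : Measurable fun x => Real.log (W₀ (Φ.flow (-t) x)) - Real.log (ψ t x) :=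
    (Real.measurable_log.comp (hW.comp (Φ.measurable_flow (-t)))).sub
      (Real.measurable_log.comp (hψ t))
  rw [← hlaw, HardSphereFlow.lawAt_eq,
    integral_map (f := fun x => Real.log (W₀ (Φ.flow (-t) x)) - Real.log (ψ t x))
      (Φ.measurable_flow t).aemeasurable hF.aestronglyMeasurable]
  -- integrability of the two pieces on the right
  have hint0 : Integrable (fun z => Real.log (ψ 0 z))
      ((liouville (Torus.geometry (Fin 3)) (N + 1) ε).withDensity fun z => ENNReal.ofReal (W₀ z)) := by
    refine (hint 0).congr ?_
    filter_upwards [hgood] with z hz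
    rw [Φ.flow_zero z hz]
  have h1int : Integrable (fun z => Real.log (W₀ z) - Real.log (ψ 0 z))
      ((liouville (Torus.geometry (Fin 3)) (N + 1) ε).withDensity fun z => ENNReal.ofReal (W₀ z)) :=
    (klDiv_ne_top_iff.mp hkl).2.congr (llr_withDensity_ofReal_ae _ hW (hψ 0) hW0 (hψpos 0))
  have h2int : Integrable (fun z => Real.log (ψ 0 z) - Real.log (ψ t (Φ.flow t z)))
      ((liouville (Torus.geometry (Fin 3)) (N + 1) ε).withDensity fun z => ENNReal.ofReal (W₀ z)) :=
    hint0.sub (hint t)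
  rw [← integral_add h1int h2int]
  refine integral_congr_ae ?_
  filter_upwards [hgood] with z hz
  rw [Φ.flow_neg_flow t hz]
  ring

/-- The conclusion of the TRANSFER form C⁺ (Yau form of the hydrodynamic limit): for all
profiles there is `σ₀` such that for `σ < σ₀`, every classical hs-Euler solution on `[0,T)`,
every flow family and the `t = 0` law of large numbers, at every `t < T` SOME activity profile
`a` makes the local Gibbs law with parameters `(a, u(t,·), θ(t,·))` (i) concentrate its three
empirical fields exponentially around `(ρ, ρu, E)(t)` and (ii) carry the time-`t` law at
vanishing specific relative entropy. (i) is statics; (ii) is the dynamical content.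
[cite: Yau1991] [cite: OllaVaradhanYau1993, Thm 2.1] -/
def YauForm : Prop :=
  ∀ (a₀ θ₀ : T3 → ℝ) (u₀ : T3 → V3), Continuous a₀ → Continuous θ₀ → Continuous u₀ →
    (∀ x, 0 < a₀ x) → (∀ x, 0 < θ₀ x) →
    ∃ σ₀ : ℝ, 0 < σ₀ ∧ ∀ σ : ℝ, 0 < σ → σ < σ₀ →
      ∀ (T : ℝ) (ρ θ : ℝ → T3 → ℝ) (u : ℝ → T3 → V3), IsHardSphereEulerSolution σ T ρ u θ →
        ∀ Φ : (N : ℕ) → HardSphereFlow (Torus.geometry (Fin 3)) (hsDiameter σ N) (N + 1),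
          TendstoHydroFieldsAt (fun N => localGibbsLaw σ a₀ u₀ θ₀ N (Φ N)) Φ ρ u θ 0 →
            ∀ t ∈ Ico 0 T, ∃ a : T3 → ℝ, Continuous a ∧ (∀ x, 0 < a x) ∧
              (∀ N, IsProbabilityMeasure (localGibbsLaw σ a (u t) (θ t) N (Φ N))) ∧
              (∀ χ : T3 → ℝ, Continuous χ → ∀ δ : ℝ, 0 < δ → ∃ c : ℝ, 0 < c ∧ ∀ᶠ N : ℕ in atTop,
                (localGibbsLaw σ a (u t) (θ t) N (Φ N)
                    {z | δ < |empiricalDensityField z χ - ∫ x, χ x * ρ t x|}).toReal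
                    ≤ Real.exp (-(c * ((N : ℝ) + 1))) ∧
                (localGibbsLaw σ a (u t) (θ t) N (Φ N)
                    {z | δ < ‖empiricalMomentumField z χ - ∫ x, (χ x * ρ t x) • u t x‖}).toReal
                    ≤ Real.exp (-(c * ((N : ℝ) + 1))) ∧
                (localGibbsLaw σ a (u t) (θ t) N (Φ N)
                    {z | δ < |empiricalEnergyField z χ -
                      ∫ x, χ x * totalEnergyDensity (ρ t x) (u t x) (θ t x)|}).toReal
                    ≤ Real.exp (-(c * ((N : ℝ) + 1)))) ∧
              Tendsto (fun N : ℕ =>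
                (InformationTheory.klDiv ((Φ N).lawAt (localGibbsLaw σ a₀ u₀ θ₀ N (Φ N)) t)
                    (localGibbsLaw σ a (u t) (θ t) N (Φ N))).toReal / ((N : ℝ) + 1))
                atTop (𝓝 0)

/-- TRANSFER C⁺ of the crux: the three hypotheses of `MacroClosure` (collisional transfer locality,
a-priori bounds, kinetic-flux closure) imply the Yau form. Stronger than `MacroClosure` (through
the entropy inequality), and Gronwall-closed: the conclusion at time `s` re-enters as the bound
at later times. [cite: Yau1991] [cite: KipnisLandim1999, Ch. 6 Thm 1.1, Remark 1.13] -/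
def RelEntropyClosure : Prop :=
  CollisionalTransferLocality → AprioriBounds → FastMomentRelaxation → YauForm

/-- Shape of the transfer, PROVED: if the Yau form yields the field convergence (entropy
inequality `KipnisLandim1999_A1_8_2` + the exponential concentration packed in `YauForm`), then C⁺
implies the crux `MacroClosure` by composition. [folklore] -/
theorem transfer_shape (hY : YauForm → _root_.HydrodynamicLimit) (hC : RelEntropyClosure) :
    MacroClosure :=
  fun h₂ h₃ hF => hY (hC h₂ h₃ hF)

end Summit.AtomisticToContinuum.HydrodynamicLimit.Cruxes.MacroClosure.LiouvilleYauTransport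

end
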